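import Mathlib
import Summits.NavierStokesRegularity.NavierStokesRegularity.Theorems.TaoLadderRungTwoBreakBlowupRigidityOneAdmissibleEternalLimit
import HarnessLib

/-!
# SURVIVAL PASSES TO THE ω-LIMIT: firing floor + two-sided self-similar clock at energy ratio `μ ≥ (1+ε₀)^{-a}` ⇒
  the continuous limit of the firing-centred translates is forward (S_a)-surviving — for the extraction stub
  `stub_eternalFromBlowup` of K2(1) `TaoLadderRungTwoBreak.BlowupRigidityOne` (stmt-NavierStokesRegularity-20206)

MODEL lattice ODEs only (Tao 2016 §4 (4.8)/(4.12), §6.4); nothing here is a statement about the Navier–Stokes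
equations; NO item is closed (`--supports stmt-NavierStokesRegularity-20206`). Route-independent; general `m`.

Centre the translates of the renormalised flow `W̃` ON THE FIRING SHELLS: frame `j` = shell shift `j`, log-time shift
`s_j = -log(T - τ_j)`. With the two-sided clock `κ₁ ≤ (Λ²μ)^k (T-τ_k)² ≤ κ₂`, frame `j` sees the firing of shell `n+j`
at the frame log-time `u = log((T-τ_j)/(T-τ_{n+j}))`, confined to a window depending on `n` only, with `a`-weighted
energy `≥ c_f κ₁ ((1+ε₀)^a μ)^n ≥ c_f κ₁` as soon as `μ ≥ (1+ε₀)^{-a}` — the LOWER clause of `Surviving a`. Continuous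
convergence transports the floor to the limit (`EternalSurvivingFwd a`). ν = 0, GENERAL ratio `μ` (the viscous kit
⟨22744⟩, `…ClockedFrames.stubSurvival_holds`, is the case `μ = (1+ε₀)⁻¹`, `a = 1`, clock `(1+ε₀)^{-2m}`; the
interpolation device for the sub-subsequence is adapted from it).

* `bigLam_sq` — `Λ² = (1+ε₀)^5`; `physWeight_mul_ge_one_of_surviving` — `(1+ε₀)^{-a} ≤ μ ⇒ 1 ≤ physWeight a ε₀ · Λ²μ`;
* `weightedEnergy_at_firing_ge` — the zero-slack inequality at the firings;
* `firing_window`, `firing_window_tendsto` — the window and its drift to `+∞` (`Λ²μ > 1`);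
* `survivingFwd_of_firingLimit` — **SURVIVAL OF THE LIMIT** from continuous convergence of the firing-centred translates.

The assembly with `admissibleEternalLimit_of_ceilings` (pinned inviscid blow-up ⇒ admissible bounded surviving eternal
ω-limit = the stub's conclusion modulo the pinning) is the next file. HONEST LABEL: the pinning data are OPEN for robust
inviscid blow-up of a fixed-spread table ((E2)+(E3) of the census); `stub_eternalIsDSS` untouched; no stub, crux or
summit is proved here.
-/

noncomputable section

-- the summit and its single sub-problem share the name (CONVENTIONS §1)
set_option linter.dupNamespace false

open Set Filter Topology MeasureTheory

namespace Summit.NavierStokesRegularity.NavierStokesRegularity.Theorems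

namespace BlowupRigidityOne

open Literature.Analysis.FluidPDE Literature.Analysis.FluidPDE.TaoCascade

variable {m : ℕ}

/-- `Λ² = (1+ε₀)^5` (`Λ = (1+ε₀)^{5/2}`). [cite: Tao2016AveragedNS, §4 (4.1) and the remark before Thm. 4.2] -/
theorem bigLam_sq {ε₀ : ℝ} (hε : 0 < ε₀) : bigLam ε₀ ^ 2 = (1 + ε₀) ^ 5 := by
  have hb : (0 : ℝ) ≤ 1 + ε₀ := by linarith
  unfold bigLam
  rw [← Real.rpow_natCast ((1 + ε₀) ^ ((5 : ℝ) / 2)) 2, ← Real.rpow_mul hb]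
  norm_num

/-- **The survival threshold in weight form**: if the energy ratio obeys the LOWER clause of `Surviving a`,
`(1+ε₀)^{-a} ≤ μ`, then `1 ≤ physWeight a ε₀ · (Λ² μ)` (`physWeight a ε₀ = (1+ε₀)^a/(1+ε₀)^5`, `Λ² = (1+ε₀)^5`).
[cite: Tao2016AveragedNS, §4 (the viscous equation before Thm. 4.2); cell vocabulary (`Surviving`, `physWeight`)] -/
theorem physWeight_mul_ge_one_of_surviving {ε₀ a μ : ℝ} (hε : 0 < ε₀) (hμ : (1 + ε₀) ^ (-a) ≤ μ) :
    1 ≤ physWeight a ε₀ * (bigLam ε₀ ^ 2 * μ) := by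
  have hb : (0 : ℝ) < 1 + ε₀ := by linarith
  have h5 : (0 : ℝ) < (1 + ε₀) ^ 5 := pow_pos hb 5
  have ha : 0 < (1 + ε₀) ^ a := Real.rpow_pos_of_pos hb a
  unfold physWeight
  have e : (1 + ε₀) ^ a / (1 + ε₀) ^ 5 * ((1 + ε₀) ^ 5 * μ) = (1 + ε₀) ^ a * μ := by
    field_simp
  rw [bigLam_sq hε, e]
  -- `1 ≤ (1+ε₀)^a μ` from `(1+ε₀)^{-a} ≤ μ`
  rw [Real.rpow_neg hb.le] at hμ
  calc (1 : ℝ) = (1 + ε₀) ^ a * ((1 + ε₀) ^ a)⁻¹ := (mul_inv_cancel₀ ha.ne').symm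
    _ ≤ (1 + ε₀) ^ a * μ := mul_le_mul_of_nonneg_left hμ ha.le

/-- **WEIGHTED ENERGY AT THE FIRINGS (zero slack).** With firing times `τ_k ∈ [0,T)`, FLOOR `c_f μ^k ≤ ‖x_k(τ_k)‖²`
and the lower CLOCK `κ₁ ≤ (Λ²μ)^k (T-τ_k)²` (`k ∈ ℕ`), and `1 ≤ physWeight a ε₀ · Λ²μ`: frame `j` (shell shift `j`,
log-time shift `-log(T-τ_j)`) sees shell `n+j` fire at frame log-time `u = log((T-τ_j)/(T-τ_{n+j}))` with
`a`-weighted renormalised energy `physWeight a ε₀ ^ n · e^{2u} ‖W̃_{n+j}(u - log(T-τ_j))‖² ≥ c_f κ₁`.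
[cite: Tao2016AveragedNS, §6.4 with §4 (4.10); cell vocabulary (`EternalSurvivingFwd`, `physWeight`)] -/
theorem weightedEnergy_at_firing_ge {ε₀ T a μ cf κ₁ : ℝ} (hε : 0 < ε₀) {X : Fin m → ℤ → ℝ → ℝ}
    {W : ℤ → ℝ → Em m}
    (hW : ∀ n σ, W n σ = (bigLam ε₀ ^ n * Real.exp (-σ)) • shellVec X n (T - Real.exp (-σ)))
    (hμ : 0 < μ) (hcf : 0 ≤ cf) (hpw : 1 ≤ physWeight a ε₀ * (bigLam ε₀ ^ 2 * μ))
    {τ : ℕ → ℝ} (hτ : ∀ k : ℕ, 0 ≤ τ k ∧ τ k < T)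
    (hfloor : ∀ k : ℕ, cf * μ ^ k ≤ ‖shellVec X (k : ℤ) (τ k)‖ ^ 2)
    (hclock₁ : ∀ k : ℕ, κ₁ ≤ (bigLam ε₀ ^ 2 * μ) ^ k * (T - τ k) ^ 2) (n j : ℕ) :
    cf * κ₁ ≤ physWeight a ε₀ ^ n * (Real.exp (2 * Real.log ((T - τ j) / (T - τ (n + j)))) *
      ‖W ((n : ℤ) + (j : ℤ)) (Real.log ((T - τ j) / (T - τ (n + j))) + -Real.log (T - τ j))‖ ^ 2) := by
  have hΛ : 0 < bigLam ε₀ := bigLam_pos (by linarith)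
  have gj : 0 < T - τ j := by linarith [(hτ j).2]
  have gk : 0 < T - τ (n + j) := by linarith [(hτ (n + j)).2]
  set q : ℝ := bigLam ε₀ ^ 2 * μ with hq_def
  have hq : 0 < q := by positivity
  have hpw0 : 0 < physWeight a ε₀ := by
    have hb : (0 : ℝ) < 1 + ε₀ := by linarith
    unfold physWeight
    positivity
  -- the argument is the firing log-time of shell `n+j`
  have harg : Real.log ((T - τ j) / (T - τ (n + j))) + -Real.log (T - τ j) = -Real.log (T - τ (n + j)) := by
    rw [Real.log_div gj.ne' gk.ne']; ring
  have hidx : (n : ℤ) + (j : ℤ) = ((n + j : ℕ) : ℤ) := by push_cast; ring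
  have hval : W ((n : ℤ) + (j : ℤ)) (Real.log ((T - τ j) / (T - τ (n + j))) + -Real.log (T - τ j)) =
      (bigLam ε₀ ^ (n + j) * (T - τ (n + j))) • shellVec X ((n + j : ℕ) : ℤ) (τ (n + j)) := by
    rw [harg, hidx, hW, neg_neg, Real.exp_log gk, sub_sub_cancel, zpow_natCast]
  have hr : 0 < (T - τ j) / (T - τ (n + j)) := div_pos gj gk
  have hexp : Real.exp (2 * Real.log ((T - τ j) / (T - τ (n + j)))) = ((T - τ j) / (T - τ (n + j))) ^ 2 := by
    rw [two_mul, Real.exp_add, Real.exp_log hr, sq]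
  have hcoef : 0 ≤ bigLam ε₀ ^ (n + j) * (T - τ (n + j)) := (mul_pos (pow_pos hΛ _) gk).le
  rw [hval, hexp, norm_smul, Real.norm_of_nonneg hcoef]
  -- algebra: the slack-free form `physWeight^n (T-τ_j)² (Λ²)^{n+j} ‖x‖²`
  have hform : physWeight a ε₀ ^ n * (((T - τ j) / (T - τ (n + j))) ^ 2 *
      (bigLam ε₀ ^ (n + j) * (T - τ (n + j)) * ‖shellVec X ((n + j : ℕ) : ℤ) (τ (n + j))‖) ^ 2) =
      physWeight a ε₀ ^ n * (T - τ j) ^ 2 * (bigLam ε₀ ^ 2) ^ (n + j) *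
        ‖shellVec X ((n + j : ℕ) : ℤ) (τ (n + j))‖ ^ 2 := by
    field_simp
    ring
  rw [hform]
  -- clock, then the weight threshold, then the floor
  have h1 : cf * μ ^ (n + j) ≤ ‖shellVec X ((n + j : ℕ) : ℤ) (τ (n + j))‖ ^ 2 := hfloor (n + j)
  have hA : 0 ≤ physWeight a ε₀ ^ n * (T - τ j) ^ 2 * (bigLam ε₀ ^ 2) ^ (n + j) := by positivity
  have h0 : 0 ≤ q ^ j * (T - τ j) ^ 2 := by positivity
  calc cf * κ₁ ≤ cf * (q ^ j * (T - τ j) ^ 2) := mul_le_mul_of_nonneg_left (hclock₁ j) hcf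
    _ = cf * 1 * (q ^ j * (T - τ j) ^ 2) := by ring
    _ ≤ cf * (physWeight a ε₀ * q) ^ n * (q ^ j * (T - τ j) ^ 2) :=
        mul_le_mul_of_nonneg_right (mul_le_mul_of_nonneg_left (one_le_pow₀ hpw) hcf) h0
    _ = physWeight a ε₀ ^ n * (T - τ j) ^ 2 * (bigLam ε₀ ^ 2) ^ (n + j) * (cf * μ ^ (n + j)) := by
        rw [hq_def]; ring
    _ ≤ physWeight a ε₀ ^ n * (T - τ j) ^ 2 * (bigLam ε₀ ^ 2) ^ (n + j) *
        ‖shellVec X ((n + j : ℕ) : ℤ) (τ (n + j))‖ ^ 2 := mul_le_mul_of_nonneg_left h1 hA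

/-- **THE FIRING WINDOW.** Under the TWO-SIDED clock `κ₁ ≤ (Λ²μ)^k (T-τ_k)² ≤ κ₂`, the frame log-time at which frame
`j` sees shell `n+j` fire lies in `[½ log(κ₁/κ₂ (Λ²μ)^n), ½ log(κ₂/κ₁ (Λ²μ)^n)]` — a window depending on `n` only.
[cite: Tao2016AveragedNS, §6.4; cell vocabulary] -/
theorem firing_window {ε₀ T μ κ₁ κ₂ : ℝ} (hε : 0 < ε₀) (hμ : 0 < μ) (hκ₁ : 0 < κ₁) (hκ₂ : 0 < κ₂)
    {τ : ℕ → ℝ} (hτ : ∀ k : ℕ, 0 ≤ τ k ∧ τ k < T)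
    (hclock₁ : ∀ k : ℕ, κ₁ ≤ (bigLam ε₀ ^ 2 * μ) ^ k * (T - τ k) ^ 2)
    (hclock₂ : ∀ k : ℕ, (bigLam ε₀ ^ 2 * μ) ^ k * (T - τ k) ^ 2 ≤ κ₂) (n j : ℕ) :
    Real.log ((T - τ j) / (T - τ (n + j))) ∈
      Icc (Real.log (κ₁ / κ₂ * (bigLam ε₀ ^ 2 * μ) ^ n) / 2) (Real.log (κ₂ / κ₁ * (bigLam ε₀ ^ 2 * μ) ^ n) / 2) := by
  have hΛ : 0 < bigLam ε₀ := bigLam_pos (by linarith)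
  have gj : 0 < T - τ j := by linarith [(hτ j).2]
  have gk : 0 < T - τ (n + j) := by linarith [(hτ (n + j)).2]
  set q : ℝ := bigLam ε₀ ^ 2 * μ with hq_def
  have hq : 0 < q := by positivity
  have hqj : 0 < q ^ j := pow_pos hq j
  have hr : 0 < (T - τ j) / (T - τ (n + j)) := div_pos gj gk
  -- `2u = log r²`, `r² = (T-τ_j)²/(T-τ_{n+j})²`
  have h2u : Real.log ((T - τ j) / (T - τ (n + j))) =
      Real.log (((T - τ j) / (T - τ (n + j))) ^ 2) / 2 := by
    rw [Real.log_pow]; push_cast; ring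
  have hr2 : ((T - τ j) / (T - τ (n + j))) ^ 2 = (T - τ j) ^ 2 / (T - τ (n + j)) ^ 2 := by rw [div_pow]
  have hA1 : κ₁ / q ^ j ≤ (T - τ j) ^ 2 := by
    rw [div_le_iff₀ hqj, mul_comm]; exact hclock₁ j
  have hA2 : (T - τ j) ^ 2 ≤ κ₂ / q ^ j := by
    rw [le_div_iff₀ hqj, mul_comm]; exact hclock₂ j
  have hB1 : κ₁ / (q ^ n * q ^ j) ≤ (T - τ (n + j)) ^ 2 := by
    rw [div_le_iff₀ (by positivity), mul_comm, ← pow_add]; exact hclock₁ (n + j)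
  have hB2 : (T - τ (n + j)) ^ 2 ≤ κ₂ / (q ^ n * q ^ j) := by
    rw [le_div_iff₀ (by positivity), mul_comm, ← pow_add]; exact hclock₂ (n + j)
  have gk2 : 0 < (T - τ (n + j)) ^ 2 := by positivity
  rw [h2u, hr2]
  constructor
  · refine div_le_div_of_nonneg_right (Real.log_le_log (by positivity) ?_) zero_le_two
    rw [le_div_iff₀ gk2]
    calc κ₁ / κ₂ * q ^ n * (T - τ (n + j)) ^ 2 ≤ κ₁ / κ₂ * q ^ n * (κ₂ / (q ^ n * q ^ j)) :=
          mul_le_mul_of_nonneg_left hB2 (by positivity)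
      _ = κ₁ / q ^ j := by field_simp
      _ ≤ (T - τ j) ^ 2 := hA1
  · refine div_le_div_of_nonneg_right (Real.log_le_log (by positivity) ?_) zero_le_two
    rw [div_le_iff₀ gk2]
    calc (T - τ j) ^ 2 ≤ κ₂ / q ^ j := hA2
      _ = κ₂ / κ₁ * q ^ n * (κ₁ / (q ^ n * q ^ j)) := by field_simp
      _ ≤ κ₂ / κ₁ * q ^ n * (T - τ (n + j)) ^ 2 := mul_le_mul_of_nonneg_left hB1 (by positivity)

/-- The lower edge of the firing window drifts to `+∞` with the frame-shell `n` (`Λ²μ > 1`). [folklore] -/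
theorem firing_window_tendsto {q κ₁ κ₂ : ℝ} (hq : 1 < q) (hκ₁ : 0 < κ₁) (hκ₂ : 0 < κ₂) :
    Tendsto (fun n : ℕ => Real.log (κ₁ / κ₂ * q ^ n) / 2) atTop atTop := by
  have h2 : Tendsto (fun n : ℕ => κ₁ / κ₂ * q ^ n) atTop atTop :=
    (tendsto_pow_atTop_atTop_of_one_lt hq).const_mul_atTop (div_pos hκ₁ hκ₂)
  exact (Real.tendsto_log_atTop.comp h2).atTop_div_const two_pos

/-- **FORWARD SURVIVAL PASSES TO THE ω-LIMIT.** Centre the translates of the renormalised flow `W̃` on the firing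
shells (`shift j`, log-time `-log(T-τ_j)`). If along a subsequence `φ` they converge CONTINUOUSLY to `W`, and the
firing data are pinned at ratio `μ` — floor `c_f μ^k ≤ ‖x_k(τ_k)‖²`, two-sided clock `κ₁ ≤ (Λ²μ)^k (T-τ_k)² ≤ κ₂`,
`Λ²μ > 1` — with `1 ≤ physWeight a ε₀ · Λ²μ` (i.e. `μ ≥ (1+ε₀)^{-a}`), then `EternalSurvivingFwd a ε₀ W` with level
`c_f κ₁`: frame-shell `n`'s firing is seen in a compact window drifting to `+∞`, a further subsequence of the firing
log-times converges, and continuous convergence carries the floor `weightedEnergy_at_firing_ge` to the limit.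
[cite: Tao2016AveragedNS, §6.4; cell vocabulary (`EternalSurvivingFwd`)] -/
theorem survivingFwd_of_firingLimit {ε₀ T a μ cf κ₁ κ₂ : ℝ} (hε : 0 < ε₀) {X : Fin m → ℤ → ℝ → ℝ}
    {W : ℤ → ℝ → Em m}
    (hW : ∀ n σ, W n σ = (bigLam ε₀ ^ n * Real.exp (-σ)) • shellVec X n (T - Real.exp (-σ)))
    (hμ : 0 < μ) (hcf : 0 < cf) (hκ₁ : 0 < κ₁) (hκ₂ : 0 < κ₂) (hq1 : 1 < bigLam ε₀ ^ 2 * μ)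
    (hpw : 1 ≤ physWeight a ε₀ * (bigLam ε₀ ^ 2 * μ))
    {τ : ℕ → ℝ} (hτ : ∀ k : ℕ, 0 ≤ τ k ∧ τ k < T)
    (hfloor : ∀ k : ℕ, cf * μ ^ k ≤ ‖shellVec X (k : ℤ) (τ k)‖ ^ 2)
    (hclock₁ : ∀ k : ℕ, κ₁ ≤ (bigLam ε₀ ^ 2 * μ) ^ k * (T - τ k) ^ 2)
    (hclock₂ : ∀ k : ℕ, (bigLam ε₀ ^ 2 * μ) ^ k * (T - τ k) ^ 2 ≤ κ₂)
    {φ : ℕ → ℕ} {Wlim : ℤ → ℝ → Em m}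
    (hconv : ∀ (n : ℤ) (v : ℕ → ℝ) (σ : ℝ), Tendsto v atTop (𝓝 σ) →
      Tendsto (fun j => W (n + ((φ j : ℕ) : ℤ)) (v j + -Real.log (T - τ (φ j)))) atTop (𝓝 (Wlim n σ))) :
    EternalSurvivingFwd a ε₀ Wlim := by
  classical
  refine ⟨cf * κ₁, mul_pos hcf hκ₁, fun N => ?_⟩
  -- choose the frame-shell `n ≥ N` so deep that the whole window lies beyond `N`
  obtain ⟨n, hLo, hnN⟩ := (((firing_window_tendsto hq1 hκ₁ hκ₂).eventually_ge_atTop (N : ℝ)).and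
    (eventually_ge_atTop N)).exists
  refine ⟨n, hnN, ?_⟩
  -- the firing log-times seen in the frames `φ j`, a bounded sequence
  set u : ℕ → ℝ := fun j => Real.log ((T - τ (φ j)) / (T - τ (n + φ j))) with hu
  have hwin : ∀ j, u j ∈ Icc (Real.log (κ₁ / κ₂ * (bigLam ε₀ ^ 2 * μ) ^ n) / 2)
      (Real.log (κ₂ / κ₁ * (bigLam ε₀ ^ 2 * μ) ^ n) / 2) := fun j =>
    firing_window hε hμ hκ₁ hκ₂ hτ hclock₁ hclock₂ n (φ j)
  obtain ⟨σ, hσmem, ψ, hψ, hlim⟩ := tendsto_subseq_of_bounded (Metric.isBounded_Icc _ _) hwin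
  rw [closure_Icc] at hσmem
  refine ⟨σ, le_trans hLo hσmem.1, ?_⟩
  -- interpolate: `v = u` on the range of `ψ`, `σ` elsewhere; `v → σ`
  set v : ℕ → ℝ := fun j => if ∃ k, ψ k = j then u j else σ with hv
  have hvlim : Tendsto v atTop (𝓝 σ) := by
    rw [Metric.tendsto_atTop]
    intro δ hδ
    obtain ⟨K, hK⟩ := Metric.tendsto_atTop.1 hlim δ hδ
    refine ⟨ψ K, fun j hj => ?_⟩
    by_cases h : ∃ k, ψ k = j
    · obtain ⟨k, rfl⟩ := h
      have hk : K ≤ k := hψ.le_iff_le.1 hj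
      have e : v (ψ k) = u (ψ k) := by rw [hv]; exact if_pos ⟨k, rfl⟩
      rw [e]
      exact hK k hk
    · have e : v j = σ := by rw [hv]; exact if_neg h
      rw [e, dist_self]
      exact hδ
  -- continuous convergence along the subsequence, at the firing log-times
  have hfr : Tendsto (fun k => W ((n : ℤ) + ((φ (ψ k) : ℕ) : ℤ)) (u (ψ k) + -Real.log (T - τ (φ (ψ k)))))
      atTop (𝓝 (Wlim n σ)) := by
    have h := (hconv (n : ℤ) v σ hvlim).comp hψ.tendsto_atTop
    refine h.congr fun k => ?_
    have e : v (ψ k) = u (ψ k) := by rw [hv]; exact if_pos ⟨k, rfl⟩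
    simp only [Function.comp_apply, e]
  -- the weighted energies converge and carry the floor
  have hg : Tendsto (fun k => physWeight a ε₀ ^ n * (Real.exp (2 * u (ψ k)) *
      ‖W ((n : ℤ) + ((φ (ψ k) : ℕ) : ℤ)) (u (ψ k) + -Real.log (T - τ (φ (ψ k))))‖ ^ 2)) atTop
      (𝓝 (physWeight a ε₀ ^ n * (Real.exp (2 * σ) * ‖Wlim n σ‖ ^ 2))) := by
    have he : Tendsto (fun k => Real.exp (2 * u (ψ k))) atTop (𝓝 (Real.exp (2 * σ))) :=
      (Real.continuous_exp.tendsto _).comp (hlim.const_mul 2)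
    exact (he.mul (hfr.norm.pow 2)).const_mul _
  have hfl : ∀ k, cf * κ₁ ≤ physWeight a ε₀ ^ n * (Real.exp (2 * u (ψ k)) *
      ‖W ((n : ℤ) + ((φ (ψ k) : ℕ) : ℤ)) (u (ψ k) + -Real.log (T - τ (φ (ψ k))))‖ ^ 2) := fun k =>
    weightedEnergy_at_firing_ge hε hW hμ hcf.le hpw hτ hfloor hclock₁ n (φ (ψ k))
  exact ge_of_tendsto hg (Eventually.of_forall hfl)

end BlowupRigidityOne

end Summit.NavierStokesRegularity.NavierStokesRegularity.Theorems

end
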